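import Summits.ABC.IUTFork.Thm311RealArchHermitian
import HarnessLib

/-!
# [IUTchIII] Theorem 3.11 over real definitions — print's archimedean integral structure on the real packet is
# STABLE under the (Ind1)/(Ind2) generators (capsule permutations; isometric summandwise families)

Proof-only file (D-0012) of the abc-iut cell (WAVE-4 D-0067 cone-interior discharge prover, seat abc-iut-w4-d001,
gen 2; home layer L6); TAKES NO SIDE on [IUTchIII] Cor. 3.12. Sequel to `Thm311RealArchShell` (p417010) and
`Thm311RealArchHermitian` (same seat): there the closed unit ball of the tensor-product Hermitian metric
([IUTchIII] Prop. 3.2 (ii) p. 98–99) was pulled back to the real archimedean packet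
`⨂_ℚ^{i ≤ j} ⊕_{w|∞} K_w` of abc-iut-c312-5's signature (`Real.archPkHermitian j`) and shown to satisfy PRINT's
(Ind3) clauses while failing the cell's typed all-places clause. THIS file records that it is preserved by the
GENERATORS of abc-iut-c312-1's indeterminacy group on the packet (`Thm311Sig`: (Ind1) = `L.permute j v_ℚ σ`
composed with factor-and-summand-wise strip-automorphisms, (Ind2) = factor-and-summand-wise `Ism`-elements) —
the archimedean counterpart of the nonarchimedean generator facts of abc-iut-c312-5's
`Cor312VolumesPadicSummands` (`strip_preserves`, `ism_preserves`) and `…PadicPerm`: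

* `Real.archComparison_permute` — a capsule permutation `σ` of `S^±_{j+1}` is intertwined by the comparison
  with `PiTensorProduct.reindex ℝ σ` on `⨂_ℝ ⊕ ℂ`; `Real.tensorForm_reindex` — the tensor-product metric is
  permutation invariant (it is the UNIQUE tensor metric, abc-iut-L4-t2/L5-t7 `isTensorMetric_unique`); hence
  **`Real.preimage_archPkHermitian_permute`**: `σ⁻¹(𝓘(^{S^±_{j+1}}𝒟⊢_∞)) = 𝓘(^{S^±_{j+1}}𝒟⊢_∞)`;
* `Real.archComparison_factorwise_summandwise` — a factor-and-summand-wise family `⊗_i ⊕_w g_{i,w}` of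
  `ℚ`-linear automorphisms of the `K_w` that are READ IN `ℂ` AS REAL-LINEAR ISOMETRIES
  (`archEmb (g_{i,w} a) = σ_{i,w} (archEmb a)`, `σ_{i,w} : ℂ ≃ₗᵢ[ℝ] ℂ` — [AbsTopIII] Prop. 5.8 (v) / [IUTchIII]
  Prop. 1.2 (vii): `log(†𝒟⊢_v) ≅ ℂ` up to `{±1} × {id, conj}`; Dupuy–Hilado §4.9 at `∞`: linear automorphisms
  preserving the closed disc are isometries) is intertwined with abc-iut-w4-d039/L5-t7's `induced σ`; hence
  **`Real.preimage_archPkHermitian_factorwise_summandwise`** (d039's `image_hermitianBallN_induced`): such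
  families preserve `𝓘(^{S^±_{j+1}}𝒟⊢_∞)`.
So with the archimedean binders `Aut`, `Ism` of `Real.logShells` instantiated by isometric automorphisms (the
only ones print allows at `∞`), every generator of `LogShells.Ind1 j`/`Ind2 j ∞` fixes print's archimedean integral
structure — what an instantiation of (a) at `v_ℚ = ∞` by `archPkHermitian` would have to check for c312-1's
`MRData.map`/B's invariance statements. Classical; [claim: Mochizuki2012, status: disputed] for every quotation.
Deliberately NOT here: log-volumes at `∞` (abc-iut-w5-d043's offered radial presentation), the closure/orbit
version along the whole indeterminacy subgroup (formal from the generator facts, abc-iut-L6-t13's pattern), any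
judgement. typed ≠ proved; instantiated ≠ endorsed.
-/

noncomputable section

namespace Summit.ABC.IUTFork.Thm311.Real

open NumberField Literature.IUT.LogVolume Literature.IUT.LogVolume.Prop15iii Literature.IUT.LogThetaLattice
open PiTensorProduct

variable {F : Type} [Field F] [NumberField F]
variable (X : PilotData F) (logv : PadicLogs F) (Aut Ism : ∀ x : Place F, Set (Carrier x ≃ₗ[ℚ] Carrier x))
  (hAut : ∀ x, LinearEquiv.refl ℚ (Carrier x) ∈ Aut x) (hIsm : ∀ x, LinearEquiv.refl ℚ (Carrier x) ∈ Ism x)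

/-! ## 1. (Ind1), permutation part -/

/-- **A capsule permutation is intertwined with `reindex` on `⨂_ℝ ⊕ ℂ`**:
`archComparison (σ·t) = reindex_ℝ σ (archComparison t)` ([IUTchIII] Thm. 3.11 (i) (Ind1) "automorphisms of the
procession", abc-iut-c312-1's `LogShells.permute`; Dupuy–Hilado §4.7). [claim: Mochizuki2012, status: disputed] -/
theorem archComparison_permute (j : (thetaIndex X).Label) (σ : Equiv.Perm ((thetaIndex X).Caps j))
    (t : (logShells X logv Aut Ism hAut hIsm).Packet j (infty X)) :
    archComparison X logv Aut Ism hAut hIsm j ((logShells X logv Aut Ism hAut hIsm).permute j (infty X) σ t) =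
      PiTensorProduct.reindex ℝ (fun _ : (thetaIndex X).Caps j => M (ArchFibre X)) σ
        (archComparison X logv Aut Ism hAut hIsm j t) := by
  have key : archComparison X logv Aut Ism hAut hIsm j ∘ₗ
        ((logShells X logv Aut Ism hAut hIsm).permute j (infty X) σ).toLinearMap =
      (PiTensorProduct.reindex ℝ (fun _ : (thetaIndex X).Caps j => M (ArchFibre X)) σ).toLinearMap.restrictScalars
          ℚ ∘ₗ archComparison X logv Aut Ism hAut hIsm j := by
    refine PiTensorProduct.ext (MultilinearMap.ext fun x => ?_)
    show archComparison X logv Aut Ism hAut hIsm j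
        ((logShells X logv Aut Ism hAut hIsm).permute j (infty X) σ ((logShells X logv Aut Ism hAut hIsm).tprod j _ x)) =
      PiTensorProduct.reindex ℝ (fun _ : (thetaIndex X).Caps j => M (ArchFibre X)) σ
        (archComparison X logv Aut Ism hAut hIsm j ((logShells X logv Aut Ism hAut hIsm).tprod j _ x))
    have hperm : (logShells X logv Aut Ism hAut hIsm).permute j (infty X) σ
          ((logShells X logv Aut Ism hAut hIsm).tprod j _ x) =
        (logShells X logv Aut Ism hAut hIsm).tprod j _ (fun i => x (σ.symm i)) :=
      PiTensorProduct.reindex_tprod σ x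
    rw [hperm, archComparison_tprod, archComparison_tprod, PiTensorProduct.reindex_tprod]
  exact LinearMap.congr_fun key t

variable [Fintype (ArchFibre X)]

/-- **The tensor-product Hermitian metric is permutation invariant**: `B₀(σx, σy) = B₀(x, y)` — the form
`(x, y) ↦ B₀(σx, σy)` is again a tensor metric (`∏_i` is permutation invariant), and the tensor metric is unique
(`isTensorMetric_unique`). [claim: Mochizuki2012, status: disputed] -/
theorem tensorForm_reindex (j : (thetaIndex X).Label) (σ : Equiv.Perm ((thetaIndex X).Caps j))
    (x y : MI ((thetaIndex X).Caps j) (ArchFibre X)) :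
    tensorForm ((thetaIndex X).Caps j) (ArchFibre X)
        (PiTensorProduct.reindex ℝ (fun _ => M (ArchFibre X)) σ x)
        (PiTensorProduct.reindex ℝ (fun _ => M (ArchFibre X)) σ y) =
      tensorForm ((thetaIndex X).Caps j) (ArchFibre X) x y := by
  set R : MI ((thetaIndex X).Caps j) (ArchFibre X) →ₗ[ℝ] MI ((thetaIndex X).Caps j) (ArchFibre X) :=
    (PiTensorProduct.reindex ℝ (fun _ : (thetaIndex X).Caps j => M (ArchFibre X)) σ).toLinearMap with hR
  have hB : IsTensorMetric ((thetaIndex X).Caps j) (ArchFibre X)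
      ((tensorForm ((thetaIndex X).Caps j) (ArchFibre X)).compl₁₂ R R) := by
    intro m m'
    rw [LinearMap.compl₁₂_apply, hR, LinearEquiv.coe_coe, PiTensorProduct.reindex_tprod,
      PiTensorProduct.reindex_tprod, isTensorMetric_tensorForm]
    exact Fintype.prod_equiv σ.symm _ _ fun _ => rfl
  have key := isTensorMetric_unique _ _ hB (isTensorMetric_tensorForm _ _)
  have := congrArg (fun B => B x y) key
  simpa only [LinearMap.compl₁₂_apply, hR, LinearEquiv.coe_coe] using this

/-- **(Ind1), permutation part, PRESERVES print's archimedean integral structure**: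
`σ⁻¹(𝓘(^{S^±_{j+1}}𝒟⊢_∞)) = 𝓘(^{S^±_{j+1}}𝒟⊢_∞)` for every capsule permutation `σ`. [claim: Mochizuki2012, status: disputed] -/
theorem preimage_archPkHermitian_permute (j : (thetaIndex X).Label) (σ : Equiv.Perm ((thetaIndex X).Caps j)) :
    (logShells X logv Aut Ism hAut hIsm).permute j (infty X) σ ⁻¹' archPkHermitian X logv Aut Ism hAut hIsm j =
      archPkHermitian X logv Aut Ism hAut hIsm j := by
  ext t
  rw [Set.mem_preimage, mem_archPkHermitian_iff, mem_archPkHermitian_iff, archComparison_permute,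
    mem_hermitianBallN_iff, mem_hermitianBallN_iff, tensorForm_reindex]

/-! ## 2. (Ind2) and the strip part of (Ind1): isometric factor-and-summand-wise families -/

omit [Fintype (ArchFibre X)] in
/-- On 1-packets: a summandwise family read in `ℂ` as the isometries `σ_w` is intertwined with
`onSummands σ`. [folklore] -/
theorem archPacket1Map_summandwise
    (g : ∀ w : ArchFibre X,
      (logShells X logv Aut Ism hAut hIsm).carrier w.1 ≃ₗ[ℚ] (logShells X logv Aut Ism hAut hIsm).carrier w.1)
    (σ : ArchFibre X → (ℂ ≃ₗᵢ[ℝ] ℂ)) (hg : ∀ w a, archEmb X w (g w a) = σ w (archEmb X w a))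
    (m : (logShells X logv Aut Ism hAut hIsm).Packet1 (infty X)) :
    archPacket1Map X logv Aut Ism hAut hIsm ((logShells X logv Aut Ism hAut hIsm).summandwise (infty X) g m) =
      onSummands (ArchFibre X) σ (archPacket1Map X logv Aut Ism hAut hIsm m) := by
  funext w
  rw [archPacket1Map_apply, onSummands_apply, archPacket1Map_apply]
  exact hg w (m w)

omit [Fintype (ArchFibre X)] in
/-- **An isometric factor-and-summand-wise family is intertwined with `induced σ`**:
`archComparison (⊗_i ⊕_w g_{i,w} · t) = induced σ (archComparison t)` whenever `archEmb ∘ g_{i,w} = σ_{i,w} ∘ archEmb`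
with real-linear isometries `σ_{i,w}` ([IUTchIII] Thm. 3.11 (i) (Ind2) / (Ind1) strip part at `∞`; abc-iut-c312-1's
`LogShells.factorwise ∘ summandwise`). [claim: Mochizuki2012, status: disputed] -/
theorem archComparison_factorwise_summandwise (j : (thetaIndex X).Label)
    (g : (thetaIndex X).Caps j → ∀ w : ArchFibre X,
      (logShells X logv Aut Ism hAut hIsm).carrier w.1 ≃ₗ[ℚ] (logShells X logv Aut Ism hAut hIsm).carrier w.1)
    (σ : (thetaIndex X).Caps j → ArchFibre X → (ℂ ≃ₗᵢ[ℝ] ℂ))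
    (hg : ∀ i w a, archEmb X w (g i w a) = σ i w (archEmb X w a))
    (t : (logShells X logv Aut Ism hAut hIsm).Packet j (infty X)) :
    archComparison X logv Aut Ism hAut hIsm j
        ((logShells X logv Aut Ism hAut hIsm).factorwise j (infty X)
          (fun i => (logShells X logv Aut Ism hAut hIsm).summandwise (infty X) (g i)) t) =
      induced ((thetaIndex X).Caps j) (ArchFibre X) σ (archComparison X logv Aut Ism hAut hIsm j t) := by
  have key : archComparison X logv Aut Ism hAut hIsm j ∘ₗ
        ((logShells X logv Aut Ism hAut hIsm).factorwise j (infty X)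
          (fun i => (logShells X logv Aut Ism hAut hIsm).summandwise (infty X) (g i))).toLinearMap =
      (induced ((thetaIndex X).Caps j) (ArchFibre X) σ).restrictScalars ℚ ∘ₗ
        archComparison X logv Aut Ism hAut hIsm j := by
    refine PiTensorProduct.ext (MultilinearMap.ext fun x => ?_)
    show archComparison X logv Aut Ism hAut hIsm j
        ((logShells X logv Aut Ism hAut hIsm).factorwise j (infty X)
          (fun i => (logShells X logv Aut Ism hAut hIsm).summandwise (infty X) (g i))
          ((logShells X logv Aut Ism hAut hIsm).tprod j _ x)) =
      induced ((thetaIndex X).Caps j) (ArchFibre X) σ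
        (archComparison X logv Aut Ism hAut hIsm j ((logShells X logv Aut Ism hAut hIsm).tprod j _ x))
    have hfac : (logShells X logv Aut Ism hAut hIsm).factorwise j (infty X)
          (fun i => (logShells X logv Aut Ism hAut hIsm).summandwise (infty X) (g i))
          ((logShells X logv Aut Ism hAut hIsm).tprod j _ x) =
        (logShells X logv Aut Ism hAut hIsm).tprod j _
          (fun i => (logShells X logv Aut Ism hAut hIsm).summandwise (infty X) (g i) (x i)) :=
      PiTensorProduct.congr_tprod _ x
    rw [hfac, archComparison_tprod, archComparison_tprod, induced_tprod]
    congr 1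
    funext i
    exact archPacket1Map_summandwise X logv Aut Ism hAut hIsm (g i) (σ i) (hg i) (x i)
  exact LinearMap.congr_fun key t

/-- **Isometric factor-and-summand-wise families PRESERVE print's archimedean integral structure**
(`(⊗_i ⊕_w g_{i,w})⁻¹(𝓘) = 𝓘`; d039's `mapsTo_hermitianBallN_induced` both ways via the inverse family).
[claim: Mochizuki2012, status: disputed] -/
theorem preimage_archPkHermitian_factorwise_summandwise (j : (thetaIndex X).Label)
    (g : (thetaIndex X).Caps j → ∀ w : ArchFibre X,
      (logShells X logv Aut Ism hAut hIsm).carrier w.1 ≃ₗ[ℚ] (logShells X logv Aut Ism hAut hIsm).carrier w.1)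
    (σ : (thetaIndex X).Caps j → ArchFibre X → (ℂ ≃ₗᵢ[ℝ] ℂ))
    (hg : ∀ i w a, archEmb X w (g i w a) = σ i w (archEmb X w a)) :
    (logShells X logv Aut Ism hAut hIsm).factorwise j (infty X)
          (fun i => (logShells X logv Aut Ism hAut hIsm).summandwise (infty X) (g i)) ⁻¹'
        archPkHermitian X logv Aut Ism hAut hIsm j =
      archPkHermitian X logv Aut Ism hAut hIsm j := by
  ext t
  rw [Set.mem_preimage, mem_archPkHermitian_iff, mem_archPkHermitian_iff,
    archComparison_factorwise_summandwise X logv Aut Ism hAut hIsm j g σ hg]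
  constructor
  · intro h
    have h' := mapsTo_hermitianBallN_induced Real.pi (fun i w => (σ i w).symm) h
    rwa [induced_symm_apply] at h'
  · exact fun h => mapsTo_hermitianBallN_induced Real.pi σ h

end Summit.ABC.IUTFork.Thm311.Real

end
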